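import Summits.NavierStokesRegularity.NavierStokesRegularity.Theses.AxisymmetricExtremality
import Summits.NavierStokesRegularity.NavierStokesRegularity.Theorems.AxisymmetricExtremalityAxisymmetricKatoGlobalStubSereginLogSwirlOriginStep1Cutoff
import Summits.NavierStokesRegularity.NavierStokesRegularity.Theorems.AxisymmetricExtremalityAxisymmetricKatoGlobalStubSereginLogSwirlOriginStep1CutoffConstants
import Summits.NavierStokesRegularity.NavierStokesRegularity.Theorems.AxisymmetricExtremalityAxisymmetricKatoGlobalStubSereginLogSwirlOriginStep1CutoffBcut
import Summits.NavierStokesRegularity.NavierStokesRegularity.Theorems.AxisymmetricExtremalityAxisymmetricKatoGlobalStubSereginLogSwirlOriginStep1CutoffCompact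
import Summits.NavierStokesRegularity.NavierStokesRegularity.Theorems.AxisymmetricExtremalityAxisymmetricKatoGlobalStubSereginLogSwirlOriginStep13Tools
import Summits.NavierStokesRegularity.NavierStokesRegularity.Theorems.AxisymmetricExtremalityAxisymmetricKatoGlobalStubSereginLogSwirlOriginStep4AssemblyKeyEstimate
import HarnessLib

/-!
# Seregin 2022, §2: the clean configuration at `(0, 1)` implies `C(R) → 0`, for the class of
# the landed key estimate (classical on the open slab) — Steps 1 + 3 + 4 chained —
# crux stmt-NavierStokesRegularity-15453 (`AxisymmetricExtremality.AxisymmetricKatoGlobal`), line registered, support for stub `stub_sereginLogSwirlOrigin`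

Support file (`--supports stmt-NavierStokesRegularity-15453`; theorems only, everything proved)
toward the registered stub `stub_sereginLogSwirlOrigin` = the named fact
`Literature.Analysis.FluidPDE.seregin2022_logSwirl_regularAtOrigin` (G. Seregin, J. Math. Fluid
Mech. 24 (2022), Paper 27 = arXiv:2201.00153, §2).  This file chains the Step-1 files of this
session (`exists_step1_cutoff`, `exists_uniform_derivBounds`, `exists_cutoff_derivBounds`,
`step3_pointwiseConstants`, `cut_bound`) with the landed Step 3 (`exists_radius_logSmall`,
`cutoff_energy_keyEstimate_unconditional`) and Step 4 (`tendsto_cubicC_of_keyEstimate`):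

* `tendsto_cubicC_of_classical_cleanConfig` (registered sub-goal) — for `(V, q)` a CLASSICAL
  axisymmetric Navier–Stokes solution on the open slab `]-1, 0[ × ℝ³` (the class of the landed
  key estimate; the Seregin–Zajaczkowski local class of the core of `…FinalReduction` awaits the
  local port of Step 3), with the swirl bound (2.2) `|σ| ≤ C₁/ln³(e/ϱ)` on `{0 < ϱ < r_σ}`,
  the energy class `∫_𝒞 |V(t)|² ≤ A`, and the clean configuration at `(0, 1)`: heights
  `h₋ < 0 < h₊`, width `δ` (`-1 ≤ h₋ - δ`, `h₋ + δ < 0 < h₊ - δ`, `h₊ + δ ≤ 1`) such that at every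
  top-slice point `a ∈ 𝒞` off the axis or within `δ` of a height all `D_xⁿV` are bounded on some
  backward cylinder `Q((0, a), ρ)` — THEN `C(R) = R⁻²∫_{Q(R)}|V|³ → 0` as `R → 0⁺`
  (`SereginSverak2009.cubicC`), the input of the landed endgame `isRegularAtOrigin_of_tendsto_cubicC`.

All numeric hypotheses of Steps 3–4 are discharged inside: the cut-off `ζ = φ(ϱ)ψ(x₃)`
(radii `1/8 < 1/4`), the smallness radius `r₁` (`exists_radius_logSmall 42 C₁`, giving
`8C₁/L + 13C₁/L² + 1 < 2` with `ε = 1/4`, `L = ln(e/r₁) ≥ 1`), the compact regular region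
`K = supp-box of ∇ζ ∪ (supp-box of ζ ∩ {ϱ ≥ r₁})`, uniform bounds `D₀, D₁, D₂` on
`K × ]-ρ², 0[`, the final slab `]t₁, 0[`, `t₁ = -(min ρ 1)²/2`, and the constants
`M, Bcut, P₀, …, P₄, L`.

## References

* G. Seregin, J. Math. Fluid Mech. 24 (2022), Paper No. 27 = arXiv:2201.00153, §2 Steps 1, 3, 4
  (arXiv pp. 5–7). [`Seregin2022LocalAxisym`]
-/

noncomputable section

open Set Filter Topology Function Metric MeasureTheory intervalIntegral
open scoped ENNReal NNReal ContDiff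
open Literature.Analysis.FluidPDE

-- `<Problem> = <Summit>` duplicates a namespace component by design (lakefile sets the same option).
set_option linter.dupNamespace false

namespace Summit.NavierStokesRegularity.NavierStokesRegularity.Theorems.AxisymmetricKatoGlobal.EulerScaling

/-! ### Small lemmas -/

section Small

/-- The smallness `8C₁/L + (13C₁/L² + 4·(1/4)) < 2` from `42C₁/L + 42C₁²/L⁴ < 2`, `L ≥ 1`,
`C₁ ≥ 0`. [folklore] -/
theorem smallness_of_logSmall {C₁ L : ℝ} (hC₁ : 0 ≤ C₁) (hL : 1 ≤ L)
    (h : 42 * C₁ / L + 42 * C₁ ^ 2 / L ^ 4 < 2) :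
    8 * C₁ / L + (13 * C₁ / L ^ 2 + 4 * (1 / 4 : ℝ)) < 2 * 1 := by
  have hL0 : 0 < L := by linarith
  have h1 : 0 ≤ 42 * C₁ ^ 2 / L ^ 4 := by positivity
  have h2 : 42 * C₁ / L < 2 := by linarith
  have h3 : C₁ / L < 1 / 21 := by
    rw [div_lt_div_iff₀ hL0 (by norm_num : (0 : ℝ) < 21)]
    have := (div_lt_iff₀ hL0).1 h2
    linarith
  have h4 : 13 * C₁ / L ^ 2 ≤ 13 * C₁ / L :=
    div_le_div_of_nonneg_left (by positivity) hL0 (show L ≤ L ^ 2 by nlinarith)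
  have h5 : 8 * C₁ / L + 13 * C₁ / L = 21 * (C₁ / L) := by ring
  nlinarith

/-- `ln(e/r) ≥ 1` for `0 < r ≤ 1`. [folklore] -/
theorem one_le_log_exp_div {r : ℝ} (hr : 0 < r) (hr1 : r ≤ 1) : 1 ≤ Real.log (Real.exp 1 / r) := by
  rw [Real.log_div (Real.exp_pos 1).ne' hr.ne', Real.log_exp]
  have := Real.log_nonpos hr.le hr1
  linarith

/-- Monotonicity of the key-estimate constant in the final time: `E ≤ E₁ + S(t − t') ≤ E₁ + S(−t')`
for `S ≥ 0`, `t ≤ 0`. [folklore] -/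
theorem le_uniform_of_le {E E₁ S t t' : ℝ} (h : E ≤ E₁ + S * (t - t')) (hS : 0 ≤ S) (ht : t ≤ 0) :
    E ≤ E₁ + S * (-t') := by
  nlinarith [mul_le_mul_of_nonneg_left (show t - t' ≤ -t' by linarith) hS]

/-- The same through a positive denominator. [folklore] -/
theorem le_uniform_div_of_le {X E₁ S t t' d : ℝ} (h : X ≤ (E₁ + S * (t - t')) / d) (hS : 0 ≤ S)
    (ht : t ≤ 0) (hd : 0 < d) : X ≤ (E₁ + S * (-t')) / d := by
  refine h.trans (div_le_div_of_nonneg_right ?_ hd.le)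
  nlinarith [mul_le_mul_of_nonneg_left (show t - t' ≤ -t' by linarith) hS]

end Small

/-! ### The chain -/

/-- **Seregin 2022, §2 Steps 1 + 3 + 4 at the normalised position `(0, 1)`, classical class:
the clean configuration implies `C(R) → 0`.** Let `(V, q)` be a classical Navier–Stokes solution
(`ν = 1`, no force) on the open slab `]-1, 0[ × ℝ³` with axisymmetric slices, satisfying the
swirl bound (2.2) `|σ(V(t))(x)| ≤ C₁/ln³(e/ϱ(x))` for `0 < ϱ(x) < r_σ` (`C₁ ≥ 0`) and the energy
bound `∫_𝒞 |V(t)|² ≤ A`, `t ∈ ]-1, 0[`. Assume the clean configuration of the core of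
`seregin2022_logSwirl_regularAtOrigin_of_cleanRepr` at `ẑ = 0`, `R = 1`: heights and width
`h₋, h₊, δ` with `δ > 0`, `-1 ≤ h₋ - δ`, `h₋ + δ < 0 < h₊ - δ`, `h₊ + δ ≤ 1`, and at every
`a ∈ 𝒞` with `0 < ϱ(a) ∨ |a₃ - h₊| < δ ∨ |a₃ - h₋| < δ` a radius `ρ > 0` such that every
`D_xⁿV` is bounded on `Q((0, a), ρ)`. Then `SereginSverak2009.cubicC 0 R V → 0` as `R → 0⁺`.
Proof: Step-1 cut-off (`exists_step1_cutoff`, radii `1/8 < 1/4`), smallness radius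
(`exists_radius_logSmall 42 C₁`), compact regular region and uniform bounds
(`exists_uniform_derivBounds`), constants (`exists_cutoff_derivBounds`, `step3_pointwiseConstants`,
`cut_bound`), the key estimate (`cutoff_energy_keyEstimate_unconditional`, `ν = 1`, `ε = 1/4`) on
`[t₁, t₂]` for every `t₂ < 0` with constants independent of `t₂`, and Step 4
(`tendsto_cubicC_of_keyEstimate`). Registered sub-goal toward `stub_sereginLogSwirlOrigin`; the
same chain for the local Seregin–Zajaczkowski class awaits the local port of the key estimate.
[cite: Seregin2022LocalAxisym, §2 Steps 1, 3, 4 (arXiv:2201.00153 pp. 5–7)] -/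
theorem tendsto_cubicC_of_classical_cleanConfig : ∀ (V : ℝ → EuclideanSpace ℝ (Fin 3) → EuclideanSpace ℝ (Fin 3)) (q : ℝ → EuclideanSpace ℝ (Fin 3) → ℝ) (hp hm δ C₁ rσ : ℝ) (A : ℝ≥0), IsClassicalNSSolutionOn (Ioo (-1 : ℝ) 0) 1 0 V q → (∀ t ∈ Ioo (-1 : ℝ) 0, IsAxisymmetric (V t)) → 0 < δ → -1 ≤ hm - δ → hm + δ < 0 → 0 < hp - δ → hp + δ ≤ 1 → 0 ≤ C₁ → 0 < rσ → (∀ t ∈ Ioo (-1 : ℝ) 0, ∀ x : EuclideanSpace ℝ (Fin 3), 0 < cylRadius x → cylRadius x < rσ → |swirl (V t) x| ≤ C₁ / Real.log (Real.exp 1 / cylRadius x) ^ 3) → (∀ t ∈ Ioo (-1 : ℝ) 0, ∫⁻ x in SereginSverak2009.spaceCyl 0 1, ‖V t x‖ₑ ^ 2 ≤ A) → (∀ a ∈ SereginSverak2009.spaceCyl (0 : EuclideanSpace ℝ (Fin 3)) 1, (0 < cylRadius a ∨ |a 2 - hp| < δ ∨ |a 2 - hm| < δ) → ∃ ρ > 0,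 ∀ n : ℕ, ∃ C : ℝ, ∀ w ∈ parabolicCylinder ρ ((0 : ℝ), a), ‖iteratedFDeriv ℝ n (V w.1) w.2‖ ≤ C) → Tendsto (fun R => SereginSverak2009.cubicC 0 R V) (𝓝[>] 0) (𝓝 0) := by
  intro V q hp hm δ C₁ rσ A hns hax hδ hm1 hm0 hp0 hp1 hC₁ hrσ hσ hA hcore
  -- Step 1 (a): the cut-off
  obtain ⟨ζ, hζC, hζax, hζc, hζ01, hplat, -, hts, hts1, hgradT, -⟩ :=
    exists_step1_cutoff (1 / 8) (1 / 4) hp hm δ (by norm_num) (by norm_num) (by norm_num) hδ hm1 hm0 hp0 hp1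
  have hζ4 : ContDiff ℝ 4 ζ := hζC.of_le (by norm_cast)
  have hζ2 : ContDiff ℝ 2 ζ := hζC.of_le (by norm_cast)
  -- Step 3 (a): the smallness radius and `r₁`
  obtain ⟨rs, hrs, hsmallr⟩ := exists_radius_logSmall 42 C₁
  set r₁ : ℝ := min (min rs rσ) (min (1 / 8) (min (hp - δ / 2) (-(hm + δ / 2)))) with hr₁def
  have hr₁pos : 0 < r₁ := by
    refine lt_min (lt_min hrs.1 hrσ) (lt_min (by norm_num) (lt_min (by linarith) (by linarith)))
  have hr₁rs : r₁ ≤ rs := (min_le_left _ _).trans (min_le_left _ _)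
  have hr₁rσ : r₁ ≤ rσ := (min_le_left _ _).trans (min_le_right _ _)
  have hr₁8 : r₁ ≤ 1 / 8 := (min_le_right _ _).trans (min_le_left _ _)
  have hr₁p : r₁ ≤ hp - δ / 2 := (min_le_right _ _).trans ((min_le_right _ _).trans (min_le_left _ _))
  have hr₁m : r₁ ≤ -(hm + δ / 2) := (min_le_right _ _).trans ((min_le_right _ _).trans (min_le_right _ _))
  have hr₁1 : r₁ < 1 := by linarith
  have hL1 : 1 ≤ Real.log (Real.exp 1 / r₁) := one_le_log_exp_div hr₁pos hr₁1.le
  have hsmall : 8 * C₁ / Real.log (Real.exp 1 / r₁) + (13 * C₁ / Real.log (Real.exp 1 / r₁) ^ 2 + 4 * (1 / 4 : ℝ)) < 2 * 1 :=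
    smallness_of_logSmall hC₁ hL1 (hsmallr r₁ ⟨hr₁pos, hr₁rs⟩)
  -- Step 1 (b): the compact regular region `K`
  set K : Set (EuclideanSpace ℝ (Fin 3)) :=
    {x | cylRadius x ≤ 1 / 4 ∧ hm - δ / 2 ≤ x 2 ∧ x 2 ≤ hp + δ / 2 ∧
      ((1 / 8 : ℝ) ≤ cylRadius x ∨ |x 2 - hp| ≤ δ / 2 ∨ |x 2 - hm| ≤ δ / 2)} ∪
    ({x | cylRadius x ≤ 1 / 4 ∧ hm - δ / 2 ≤ x 2 ∧ x 2 ≤ hp + δ / 2} ∩ {x | r₁ ≤ cylRadius x}) with hKdef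
  have hKbox : K ⊆ {x | cylRadius x ≤ 1 / 4 ∧ hm - δ / 2 ≤ x 2 ∧ x 2 ≤ hp + δ / 2} := by
    rintro x (⟨h1, h2, h3, -⟩ | ⟨hx, -⟩)
    exacts [⟨h1, h2, h3⟩, hx]
  have hKc : IsCompact K :=
    (isCompact_box (by norm_num) hδ hm1 hp1).of_isClosed_subset
      ((isClosed_gradBox _ _ _ _ _ _ _).union ((isClosed_box _ _ _).inter
        (isClosed_le continuous_const continuous_cylRadius))) hKbox
  have hKgrad : tsupport (fderiv ℝ ζ) ⊆ K := fun x hx => Or.inl (hgradT hx)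
  have hKfar : ∀ x ∈ tsupport ζ, r₁ ≤ cylRadius x → x ∈ K := fun x hx hr => Or.inr ⟨hts hx, hr⟩
  have hKgood : ∀ a ∈ K, a ∈ SereginSverak2009.spaceCyl (0 : EuclideanSpace ℝ (Fin 3)) 1 ∧
      (0 < cylRadius a ∨ |a 2 - hp| < δ ∨ |a 2 - hm| < δ) := by
    intro a ha
    refine ⟨box_subset_spaceCyl (by norm_num) hδ hm1 hp1 (hKbox ha), ?_⟩
    rcases ha with ⟨-, -, -, h4⟩ | ⟨-, hr⟩
    · exact good_of_mem_gradBox (by norm_num) hδ h4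
    · exact Or.inl (hr₁pos.trans_le hr)
  -- Step 1 (c): uniform bounds on `K` up to the top time
  obtain ⟨ρ, hρ, D₀, D₁, D₂, hD₀, hD₁, hD₂, hD⟩ := exists_uniform_derivBounds V K hKc
    fun a ha => hcore a (hKgood a ha).1 (hKgood a ha).2
  obtain ⟨Z₁, Z₂, Z₃, Q₀, Q₁, hZ₁0, hZ₂0, hZ₃0, hQ₀0, hQ₁0, hZ₁, hZ₂, hZ₃, hQ₀, hQ₁⟩ :=
    exists_cutoff_derivBounds hζ4 hζc hζax
  -- the final slab `]t₁, 0[`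
  set ρ' : ℝ := min ρ 1 with hρ'
  have hρ'0 : 0 < ρ' := lt_min hρ one_pos
  set t₁ : ℝ := -ρ' ^ 2 / 2 with ht₁def
  have ht₁0 : t₁ < 0 := by rw [ht₁def]; have := pow_pos hρ'0 2; linarith
  have ht₁1 : -1 < t₁ := by
    rw [ht₁def]
    have h1 : ρ' ^ 2 ≤ 1 := by
      have := pow_le_pow_left₀ hρ'0.le (min_le_right ρ 1) 2
      simpa using this
    linarith
  have ht₁ρ : -ρ ^ 2 < t₁ := by
    rw [ht₁def]
    have h1 : ρ' ^ 2 ≤ ρ ^ 2 := pow_le_pow_left₀ hρ'0.le (min_le_left ρ 1) 2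
    have := pow_pos hρ'0 2
    linarith
  have hslab : ∀ t, t₁ ≤ t → t < 0 → t ∈ Ioo (-1 : ℝ) 0 ∧ t ∈ Ioo (-ρ ^ 2) 0 := fun t h1 h2 =>
    ⟨⟨ht₁1.trans_le h1, h2⟩, ⟨ht₁ρ.trans_le h1, h2⟩⟩
  -- regularity of the slices
  have hV : ∀ t ∈ Ioo (-1 : ℝ) 0, ContDiff ℝ 4 (V t) := fun t ht =>
    (hns.contDiff_velocity ht).of_le (by norm_cast)
  have hV3 : ∀ t ∈ Ioo (-1 : ℝ) 0, ContDiff ℝ 3 (V t) := fun t ht => (hV t ht).of_le (by norm_num)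
  -- the constants
  set κ : ℝ := ‖curlCLM‖ with hκ
  set Vb : ℝ := volume.real (closedBall (0 : EuclideanSpace ℝ (Fin 3)) 2) with hVb
  have hVb0 : 0 ≤ Vb := measureReal_nonneg
  set M : ℝ := D₁ * (κ * D₂) ^ 2 with hMdef
  set P₀ : ℝ := D₀ * D₁ * Z₁ + 4 * D₁ ^ 2 with hP₀def
  set P₁ : ℝ := D₁ * D₀ * Z₁ with hP₁def
  set P₂ : ℝ := κ * D₂ * Z₁ * (4 * D₁ ^ 2) with hP₂def
  set P₃ : ℝ := Z₁ * D₂ + Z₂ * D₁ + Q₀ * D₁ + Q₁ * D₀ with hP₃def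
  set P₄ : ℝ := Z₁ * D₂ + 2 * Z₂ * D₁ + Z₃ * D₀ with hP₄def
  set Bcut : ℝ := 2 * ((2 * (Z₁ * D₀) + 2 * 1 * Z₁ ^ 2 + 4 * 1 * Q₀) * (κ * D₂) ^ 2 * Vb) with hBcutdef
  have hκ0 : 0 ≤ κ := by rw [hκ]; exact norm_nonneg curlCLM
  have hM0 : 0 ≤ M := by positivity
  have hP₂0 : 0 ≤ P₂ := by positivity
  have hBcut0 : 0 ≤ Bcut := by positivity
  -- pointwise constants at every time of the slab
  have hpt : ∀ t, t₁ ≤ t → t < 0 → _ := fun t h1 h2 =>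
    step3_pointwiseConstants (V t) ζ K r₁ D₀ D₁ D₂ Z₁ Z₂ Z₃ Q₀ Q₁ (hV3 t (hslab t h1 h2).1)
      (hax t (hslab t h1 h2).1) hζ4 hζax hζ01 hKgrad hKfar hD₀ hD₁ hD₂ hZ₁0 hZ₂0 hZ₃0 hQ₀0 hZ₁ hZ₂ hZ₃ hQ₀ hQ₁
      (fun x hx => (hD t (hslab t h1 h2).2 x hx).1) (fun x hx => (hD t (hslab t h1 h2).2 x hx).2.1)
      (fun x hx => (hD t (hslab t h1 h2).2 x hx).2.2)
  have hcutt : ∀ t, t₁ ≤ t → t < 0 → _ := fun t h1 h2 =>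
    cut_bound (V t) ζ K (-1) 0 1 t D₀ D₂ Z₁ Q₀ Vb (hV3 t (hslab t h1 h2).1) (hax t (hslab t h1 h2).1) hζ2
      hζax hζ01 hts1 hKgrad zero_le_one hD₀ hD₂ hZ₁0 hQ₀0 le_rfl hZ₁ hQ₀
      (fun x hx => (hD t (hslab t h1 h2).2 x hx).1) (fun x hx => (hD t (hslab t h1 h2).2 x hx).2.2)
  -- the cut-off as a (time-independent) space-time function
  have hζst : IsSmoothSpaceTimeOn (Ioo (-1 : ℝ) 0) (fun _ : ℝ => ζ) := (hζC.comp contDiff_snd).contDiffOn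
  -- Step 3: the key estimate on `[t₁, t₂]`, every `t₂ ∈ ]t₁, 0[`
  have hkey : ∀ t₂ ∈ Ioo t₁ 0, _ := fun t₂ ht₂ =>
    cutoff_energy_keyEstimate_unconditional (-1) 0 1 V q (fun _ : ℝ => ζ) t₁ t₂ C₁ r₁ M Bcut (1 / 4) P₀ P₁ P₂ P₃ P₄ Vb
      hns hax zero_le_one hζst (fun s _ => hζax) (fun s _ => hts1)
      (fun t ht => (hslab t ht.1 (ht.2.trans_lt ht₂.2)).1) ht₂.1.le hC₁ hr₁pos hr₁1 hM0 hBcut0 (by norm_num) hP₂0 le_rfl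
      (fun t ht x hx0 hxr => hσ t (hslab t ht.1 (ht.2.trans_lt ht₂.2)).1 x hx0 (hxr.trans_le hr₁rσ))
      (fun t ht => (hpt t ht.1 (ht.2.trans_lt ht₂.2)).1)
      (fun t ht => hcutt t ht.1 (ht.2.trans_lt ht₂.2))
      (fun t ht => (hpt t ht.1 (ht.2.trans_lt ht₂.2)).2.1)
      (fun t ht => (hpt t ht.1 (ht.2.trans_lt ht₂.2)).2.2.1)
      (fun t ht => (hpt t ht.1 (ht.2.trans_lt ht₂.2)).2.2.2.1)
      (fun t ht => (hpt t ht.1 (ht.2.trans_lt ht₂.2)).2.2.2.2.1)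
      (fun t ht => (hpt t ht.1 (ht.2.trans_lt ht₂.2)).2.2.2.2.2.1)
      hsmall
  -- uniformity of the constants in `t₂`
  have hL0 : 0 < Real.log (Real.exp 1 / r₁) := zero_lt_one.trans_le hL1
  have hSc0 : 0 ≤ Bcut + (12 * C₁ * (P₃ ^ 2 + P₄ ^ 2) * Vb / Real.log (Real.exp 1 / r₁) ^ 2 +
      ((P₀ ^ 2 + P₁ ^ 2) / (2 * (1 / 4 : ℝ)) + 2 * P₂) * Vb) + 4 * M * Vb := by positivity
  have hden0 : 0 < 2 * 1 - 8 * C₁ / Real.log (Real.exp 1 / r₁) -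
      (13 * C₁ / Real.log (Real.exp 1 / r₁) ^ 2 + 4 * (1 / 4 : ℝ)) := by linarith only [hsmall]
  -- Step 4 inputs: continuity in time of the dissipation densities
  have hS : IsOpen (Ioo (-1 : ℝ) 0) := isOpen_Ioo
  have hU : UniqueDiffOn ℝ (Ioo (-1 : ℝ) 0) := hS.uniqueDiffOn
  have hc : Convex ℝ (Ioo (-1 : ℝ) 0) := convex_Ioo _ _
  have hsm : IsSmoothSpaceTimeOn (Ioo (-1 : ℝ) 0) V := hns.smooth_velocity
  have hΓst : IsSmoothSpaceTimeOn (Ioo (-1 : ℝ) 0) fun s => angVortQuot (V s) := hsm.angVortQuot_family hc hU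
  have hΦst : IsSmoothSpaceTimeOn (Ioo (-1 : ℝ) 0) fun s => radVelQuot (curl (V s)) :=
    (hsm.isSmoothSpaceTimeOn_vorticity hU).radVelQuot_family hc hU
  have hsupp0 : ∀ t ∈ Ioo (-1 : ℝ) 0, ∀ x ∉ tsupport ζ, (fun _ : ℝ => ζ) t x = 0 := fun t _ x hx =>
    image_eq_zero_of_notMem_tsupport hx
  have hIco : Ico t₁ 0 ⊆ Ioo (-1 : ℝ) 0 := fun t ht => ⟨ht₁1.trans_le ht.1, ht.2⟩
  have hDΓc := (continuousOn_integral_gradSq_cutoff hS hζst hΓst hζc hsupp0).mono hIco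
  have hDΦc := (continuousOn_integral_gradSq_cutoff hS hζst hΦst hζc hsupp0).mono hIco
  -- Step 4 inputs: measurability, divergence, plateau, bounds on `supp ∇ζ`
  have hmeas : AEStronglyMeasurable (uncurry V) (volume.restrict (SereginSverak2009.parCyl (0 : ℝ × EuclideanSpace ℝ (Fin 3)) r₁)) := by
    refine (hsm.continuousOn.mono fun z hz => ?_).aestronglyMeasurable (SereginSverak2009.isOpen_parCyl 0 r₁).measurableSet
    have h1 := (SereginSverak2009.mem_parCyl_zero.1 hz).1
    have hr2 : r₁ ^ 2 < 1 := pow_lt_one₀ hr₁pos.le hr₁1 two_ne_zero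
    exact ⟨⟨by linarith only [h1.1, hr2], h1.2⟩, mem_univ _⟩
  have hdiv : ∀ t ∈ Ioo t₁ 0, ∀ x ∈ (univ : Set (EuclideanSpace ℝ (Fin 3))), VectorCalculus.divergence (V t) x = 0 :=
    fun t ht x _ => hns.divFree t (hslab t ht.1.le ht.2).1 x
  have hζr₁ : ∀ x ∈ SereginSverak2009.spaceCyl (0 : EuclideanSpace ℝ (Fin 3)) r₁, ζ x = 1 := fun x hx => by
    obtain ⟨h1, h2, h3⟩ := spaceCyl_subset_box hr₁8 hr₁p hr₁m hx
    exact hplat x h1 h2 h3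
  have hLv : ∀ t ∈ Ioo t₁ 0, ∀ x, fderiv ℝ ζ x ≠ 0 → ‖V t x‖ ≤ D₀ := fun t ht x hx =>
    (hD t (hslab t ht.1.le ht.2).2 x (hKgrad (subset_tsupport _ (mem_support.2 hx)))).1
  -- Step 4
  exact tendsto_cubicC_of_keyEstimate V ζ univ t₁ r₁ D₀ _ _ A ht₁0 hr₁pos hr₁1.le hmeas
    (fun t ht => hV t (hslab t ht.1.le ht.2).1) (fun t ht => hax t (hslab t ht.1.le ht.2).1) isOpen_univ hdiv
    hζ2 (subset_univ _) hts1 hζr₁ (fun t ht => hA t (hslab t ht.1.le ht.2).1) hLv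
    (fun t ht => le_uniform_of_le ((hkey t ht).1 t ⟨ht.1.le, le_rfl⟩) hSc0 ht.2.le) hDΓc hDΦc
    (fun t₂ ht₂ => le_uniform_div_of_le (hkey t₂ ht₂).2 hSc0 ht₂.2.le hden0)

/-! ### Corollaries: the regular origin, and a.e. invariance of `C(R)` -/

/-- **`C(R)` does not see null sets**: if `v = V` a.e. on `Q = Q(0, 1)` then
`cubicC 0 R v = cubicC 0 R V` for `0 ≤ R ≤ 1`. [folklore] -/
theorem cubicC_congr_ae {v V : ℝ → EuclideanSpace ℝ (Fin 3) → EuclideanSpace ℝ (Fin 3)}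
    (hae : uncurry v =ᵐ[volume.restrict (SereginSverak2009.parCyl (0 : ℝ × EuclideanSpace ℝ (Fin 3)) 1)] uncurry V)
    {R : ℝ} (hR : 0 ≤ R) (hR1 : R ≤ 1) :
    SereginSverak2009.cubicC 0 R v = SereginSverak2009.cubicC 0 R V := by
  unfold SereginSverak2009.cubicC
  congr 1
  refine lintegral_congr_ae ?_
  have h := ae_restrict_of_ae_restrict_of_subset (SereginSverak2009.parCyl_mono 0 hR hR1) hae
  filter_upwards [h] with z hz
  have e : v z.1 z.2 = V z.1 z.2 := hz
  rw [e]

/-- **`C(R) → 0` does not see null sets**: `cubicC 0 R v → 0` iff `cubicC 0 R V → 0` as `R → 0⁺`,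
when `v = V` a.e. on `Q`. [folklore] -/
theorem tendsto_cubicC_congr_ae {v V : ℝ → EuclideanSpace ℝ (Fin 3) → EuclideanSpace ℝ (Fin 3)}
    (hae : uncurry v =ᵐ[volume.restrict (SereginSverak2009.parCyl (0 : ℝ × EuclideanSpace ℝ (Fin 3)) 1)] uncurry V)
    (h : Tendsto (fun R => SereginSverak2009.cubicC 0 R V) (𝓝[>] 0) (𝓝 0)) :
    Tendsto (fun R => SereginSverak2009.cubicC 0 R v) (𝓝[>] 0) (𝓝 0) := by
  refine h.congr' ?_
  filter_upwards [Ioc_mem_nhdsGT (zero_lt_one' ℝ)] with R hR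
  exact (cubicC_congr_ae hae hR.1.le hR.2).symm

/-- **The regular origin, classical class** (Steps 1–4 chained with the landed endgame
`isRegularAtOrigin_of_tendsto_cubicC`): under the hypotheses of
`tendsto_cubicC_of_classical_cleanConfig` for `(V, q)` and, for a field `v` equal to `V` a.e. on
`Q`, the Def-1.1 data of the fact (`v` suitable weak on `Q`, energy class, weak gradient in `L²`,
`q ∈ L^{3/2}`), the origin is a regular point of `v`. [cite: Seregin2022LocalAxisym, §2 Steps 1–4 (arXiv:2201.00153 pp. 5–7)] -/
theorem isRegularAtOrigin_of_classical_cleanConfig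
    {v V : ℝ → EuclideanSpace ℝ (Fin 3) → EuclideanSpace ℝ (Fin 3)} {q : ℝ → EuclideanSpace ℝ (Fin 3) → ℝ}
    (hsw : IsSuitableWeakSolutionOn (SereginSverak2009.parCylOpens 0 1) 1 0 v q)
    (hA₀ : ∃ C : ℝ≥0, ∀ᵐ t ∂(volume.restrict (Ioo (-1 : ℝ) 0)),
      ∫⁻ x in SereginSverak2009.spaceCyl 0 1, ‖v t x‖ₑ ^ 2 ≤ C)
    (hG : ∃ G : ℝ → EuclideanSpace ℝ (Fin 3) → EuclideanSpace ℝ (Fin 3) →L[ℝ] EuclideanSpace ℝ (Fin 3),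
      HasWeakSpatialGradientOn (SereginSverak2009.parCylOpens 0 1) v G ∧
      ∫⁻ z in SereginSverak2009.parCyl 0 1, ENNReal.ofReal (frobeniusNormSq (G z.1 z.2)) < (⊤ : ℝ≥0∞))
    (hq : ∫⁻ z in SereginSverak2009.parCyl 0 1, ‖q z.1 z.2‖ₑ ^ (3 / 2 : ℝ) < (⊤ : ℝ≥0∞))
    (hae : uncurry v =ᵐ[volume.restrict (SereginSverak2009.parCyl (0 : ℝ × EuclideanSpace ℝ (Fin 3)) 1)] uncurry V)
    {hp hm δ C₁ rσ : ℝ} {A : ℝ≥0} (hns : IsClassicalNSSolutionOn (Ioo (-1 : ℝ) 0) 1 0 V q)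
    (hax : ∀ t ∈ Ioo (-1 : ℝ) 0, IsAxisymmetric (V t)) (hδ : 0 < δ) (hm1 : -1 ≤ hm - δ)
    (hm0 : hm + δ < 0) (hp0 : 0 < hp - δ) (hp1 : hp + δ ≤ 1) (hC₁ : 0 ≤ C₁) (hrσ : 0 < rσ)
    (hσ : ∀ t ∈ Ioo (-1 : ℝ) 0, ∀ x : EuclideanSpace ℝ (Fin 3), 0 < cylRadius x → cylRadius x < rσ →
      |swirl (V t) x| ≤ C₁ / Real.log (Real.exp 1 / cylRadius x) ^ 3)
    (hA : ∀ t ∈ Ioo (-1 : ℝ) 0, ∫⁻ x in SereginSverak2009.spaceCyl 0 1, ‖V t x‖ₑ ^ 2 ≤ A)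
    (hcore : ∀ a ∈ SereginSverak2009.spaceCyl (0 : EuclideanSpace ℝ (Fin 3)) 1,
      (0 < cylRadius a ∨ |a 2 - hp| < δ ∨ |a 2 - hm| < δ) → ∃ ρ > 0, ∀ n : ℕ, ∃ C : ℝ,
        ∀ w ∈ parabolicCylinder ρ ((0 : ℝ), a), ‖iteratedFDeriv ℝ n (V w.1) w.2‖ ≤ C) :
    SereginSverak2009.IsRegularAtOrigin v :=
  isRegularAtOrigin_of_tendsto_cubicC v q hsw hA₀ hG hq (tendsto_cubicC_congr_ae hae
    (tendsto_cubicC_of_classical_cleanConfig V q hp hm δ C₁ rσ A hns hax hδ hm1 hm0 hp0 hp1 hC₁ hrσ hσ hA hcore))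

end Summit.NavierStokesRegularity.NavierStokesRegularity.Theorems.AxisymmetricKatoGlobal.EulerScaling

end
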